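import Summits.AtomisticToContinuum.FouriersLaw.Theorems.BondHeatUncertaintyBoundedResponseThoulessWindow
import Summits.AtomisticToContinuum.FouriersLaw.Theorems.BondHeatUncertaintySubdiffusiveBondHeatKernelDetailedBalance
import Summits.AtomisticToContinuum.FouriersLaw.Theorems.BondHeatUncertaintySubdiffusiveBondHeatSiteEnergyDynkin
import Summits.AtomisticToContinuum.FouriersLaw.Theorems.BondHeatUncertaintySubdiffusiveBondHeatSiteEnergyCurrentCovariance
import Summits.AtomisticToContinuum.FouriersLaw.Theorems.BondHeatUncertaintySubdiffusiveBondHeatBathBondReductionCorrelations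
import Summits.AtomisticToContinuum.FouriersLaw.Theorems.BoundaryEscapeDeficitBoundaryKernelBasics
import HarnessLib

/-!
# BondHeatUncertainty / BoundedResponse — «BathHeat»: the bath-side Einstein–Helfand identity and the amplitude-free kernel door
(decomp-a2c lens-1 «grading / quantitative ladder», g107, NODE 107; blocker item stmt-AtomisticToContinuum-11071 = `BoundedResponse`)

## Thesis (NODE 107)

The blocker `11071 ⟺ (E_N ≤ C₁/N)` (`ohmicFloor_iff_boundedResponse`; `E_N = escapeDeficit`, `G_N = γT²(N−1)²E_N` by `totalGK_eq`) is read on the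
BATH SIDE.  Everything below is at equilibrium (`T_L = T_R = T`, stationary Markov family `transitionKernel N T T`, Gibbs law `μ_T`), fixed `N`.

* ★ IDENTITY (§2, `pinnedChain_bathHeat_sq_eq`).  The heat absorbed from the LEFT bath on `[0,t]`, `Q^L_t := ∫₀ᵗ j₀(z_s)ds + e₀(z_t) − e₀(z_0)`
  (`j₀` = bond current `0 → 1`, `e₀` = site-0 energy), has `E[(Q^L_t)²] = W_N(t) := 2γT²t − 2γ²∫₀ᵗ(t−r)K_N(r)dr` EXACTLY, where
  `K_N(r) := ∫ (p₀²−T)·(P_r(p₀²−T)) dμ_T` (`bathKinCorr`) is the very kernel defining `escapeDeficit` (`escapeDeficit_eq_bathKinCorr`, `rfl`).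
* ★ EINSTEIN–HELFAND SPLIT (§4, `bathHeatVar_eq_escapeDeficit_add_bathTail`, `tendsto_bathHeatVar_div_atTop`).
  `W_N(t)/2 = t·γT²·E_N + B_N(t)`, `B_N(t) := γ²∫_{(0,∞)} min(r,t)K_N(r)dr` (`bathTail`), and `W_N(t)/(2t) → γT²E_N` (`t → ∞`, unconditionally):
  the blocker's scalar `E_N` IS the diffusivity of the bath-heat Helfand moment; 11071 says it is `O(1/N)`.
* ★ TRANSFER (§3, `heatSpread_bathHeatVar_compare`).  `V_N(t) ≤ 2(N−1)²W_N(t) + C·N³` and `(N−1)²W_N(t) ≤ 2V_N(t) + C·N³` for ALL `t ≥ 0`, `N ≥ 2`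
  (`V_N = heatSpread`, the blocker-side Helfand variance; `C = 80·C_W` from (W) `extensiveBlockEnergyVariance_holds`).  Hence
  `(HSᴾ_{h+2}) ⟺ (BHᴾ_h)` for every `h ≥ 1` (`heatSpreadPoint_iff_bathHeatPoint`), and the two TAIL functionals differ exactly by the transfer
  defect: `Tr_N(t) + (N−1)²B_N(t) = ((N−1)²W_N(t) − V_N(t))/2` (`gkTail_add_sq_mul_bathTail_eq`).
* ★★ DOOR (§4, exact, no transfer error): `11071 ⟸ (BHᴾ_1) ∧ (BTᶠ_1)` (`boundedResponse_of_bathHeatPoint_bathTailFloor`);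
  `(BTᶠ_1) ⟸ 11071` (`bathTailFloor_one_of_boundedResponse`); `(BHᴾ_1) ⟸ (S)` (`bathHeatPoint_one_of_subdiffusiveBondHeat`); so beneath `N_S`
  the blocker IS the bath tail floor: `(S) ⟹ (11071 ⟺ (BTᶠ_1))` (`boundedResponse_iff_bathTailFloor_of_subdiffusiveBondHeat`); dually
  `11071 ∧ (BTᶜ_1) ⟹ (BHᴾ_1)` and `(BTᶜ_1) → (BTᶠ_1) → (11071 ⟺ (BHᴾ_1))` (`boundedResponse_iff_bathHeatPoint_of_bathTail`).
* ★★ SPLIT BENEATH, AMPLITUDE-FREE (§5): `(BTᶠ_1) ⟸ (BKᶠ_{0,3/2})` := «`K_N(r) ≥ −A·r^{−3/2}` for `r ≥ r₀`, `N ≥ N₀`,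
  with `A, r₀` INDEPENDENT of `N`»
  (`bathTailFloor_one_of_bathKernelFloor`; general bookkeeping `(BKᶠ_{p,α}) ⟹ (BTᶠ_{max(p,0)+4−2α})`, `1 < α < 2`), hence
  `11071 ⟸ (S) ∧ (BKᶠ_{0,3/2})` (`boundedResponse_of_subdiffusiveBondHeat_bathKernelFloor`); sign version `(BK⁺) ⟹ (BTᶠ_0)`,
  `11071 ⟸ (BHᴾ_1) ∧ (BK⁺)`.  Free rungs: `(BTᶠ_2)`, `(BHᴾ_3)` (`⟺ HSᴾ_5`).

ANSWER to row 1463 (4) «where does the amplitude 1/N live?» — on the blocker side (NODE 106) in `(PTGᶜ_{−1})`; on the BATH side NOWHERE: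
the `(N−1)²` prefactor of `G_N` is absorbed EXACTLY by the pathwise identity `∫₀ᵗJ = (N−1)Q^L_t + G(z_t) − G(z_0)` (§3), the weight `min(r,cN²)`
replaces it, and at the diffusive rate `α = 3/2` a ONE-SIDED floor with amplitude `N⁰` already yields grade 1.  Beneath `N_S` the residual of 11071
is therefore a SIGN/DECAY property of ONE scalar function `r ↦ K_N(r)` of ONE site, uniform in `N` — not a cancellation among `N²` bond pairs.

## Dictionary (blocker side ↔ bath side)
`G_N ↔ γT²(N−1)²·E_N` (exact, tree) · `V_N(t) ↔ (N−1)²W_N(t)` (up to `O(V_N + (N−1)²W_N) + O(N³)`, §3; sharp enough exactly at grade 3 ↔ 1) ·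
`Tr_N(t) ↔ −(N−1)²B_N(t)` (exact up to the same defect, `gkTail_add_sq_mul_bathTail_eq`) · `(HSᴾ_{h+2}) ↔ (BHᴾ_h)` (`h ≥ 1`, PROVED) ·
`(TCᶜ_3) ↔ (BTᶠ_1)` (both `⟺ 11071` beneath (S), PROVED; off the (S) branch UNDECIDED) · `(TCᶠ_3 = GKTailFloor 3) ↔ (BTᶜ_1)` (UNDECIDED) ·
`(PTDᶜ_{p,α})` (two-sided, amplitude `N^p`, `p ≤ 2α−1` for grade 3) ↔ `(BKᶠ_{p,α})` (ONE-sided, `p ≤ 2α−3` for grade 1; `p = 0` at `α = 3/2`).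

## Tags (pieces; 11071 = the target)
(BHᴾ_1) `BathHeatPoint 1`: UNDECIDED · ⟸ (S) PROVED · TRUE-leaning · phonon-FALSE (`W^{harm}_N(cN²) ≈ 2cγT²E_∞N²`, heuristic) · INSTRUMENTABLE.
(BTᶠ_1) `BathTailFloor 1`: WEAKER (⟸ 11071 PROVED) · UNDECIDED · TRUE-leaning · phonon-compatible · INSTRUMENTABLE · = 11071 beneath (S) (EQUIV layer).
(BTᶜ_1) `BathTailCeiling 1`: UNDECIDED · ⟸ (BHᴾ_1) PROVED · phonon-compatible.
(BKᶠ_{0,3/2}) `BathKernelFloor 0 (3/2)`: INCOMPARABLE (sufficient for (BTᶠ_1), pointwise) · UNDECIDED · TRUE-leaning · phonon-TRUE (Wick: `K^{harm}_N =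
2·Cov(p₀(0),p₀(r))² ≥ 0`, heuristic H5) · INSTRUMENTABLE · IDEA-NEEDED for a proof (positivity / hydrodynamic floor of a boundary energy autocorrelation).
(BK⁺) `BathKernelNonneg`: INCOMPARABLE · UNDECIDED (anharmonic: plausibly false at microscopic lags unless `r₀ > 0`; typed with `r₀`) · phonon-TRUE.
COSTUME CHECK: none of the six Props mentions `escapeDeficit`, `totalGK`, `∫₀^∞ K_N` or a `t → ∞` limit; (BHᴾ)/(BTᶠ)/(BTᶜ) constrain `W_N`, `B_N` at the
single time `cN²`, (BKᶠ)/(BK⁺) constrain `K_N` pointwise past `r₀`; the identity `W/2 = tγT²E + B` shows `(BHᴾ_1) ∧ (BTᶠ_1)` is EQUIVALENT to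
`11071 ∧ (BTᶠ_1) ∧ (BHᴾ_1)` only jointly — each piece alone is phonon-compatible or (S)-implied (MustFail probes M1–M5 in the probes file).

## Why this line, and the dead ends it replaces (critic row 1463 item 1, literal form)
Item 1 asked for the open-system Green–Kubo identity at the AUTOCORRELATION level with the symmetric boundary observable `B_N = ((N−1)/2)γ(p₀² − p²_{N−1})`.
Dead ends found (memo NODE-g107 §2): (i) the symmetric centred moment splits `C_N` into pieces each `≍ N^{1/2}` against a target `≍ N^{−3/2}` — the
cancellation IS Fourier's law; (ii) `d/ds ⟪B, P_sJ⟫` with the generator in the LEFT slot needs semigroup-domain regularity the tree does not have;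
(iii) kernel-only cross terms give `N^{3/2}`.  The ONE-BATH, VARIANCE-level identity avoids all three: right-slot Dynkin only (`stub_siteEnergyDynkin`),
detailed balance (`stub_kernelDetailedBalance` via `kpair_parity`), statics with equality, and the path second moments — all LANDED.

## Novelty
NEW as typed statements: the finite-`N`, all-`t` bath-heat variance identity with the blocker's kernel; the `O(N³)` two-way transfer `V_N ≍ (N−1)²W_N`
uniform in `t`; the exact bath-local door and the amplitude-free kernel door.  Nearest prior art (presearch, both corpora):
[corpus:arxiv-0809.4543 p.3, eqs. (reln2)–(reln3) + conductance formula] Kundu–Dhar–Narayan, open-system Green–Kubo: response = `∫₀^∞` of current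
autocorrelations, boundary current `J_b`, detailed balance + continuity — the MECHANISM (folklore here), not the finite-time variance split nor the door;
[corpus:gaspard2022-statistical-mechanics-irreversible-phenomena p.261, eqs. (3.116)–(3.117)] Einstein–Helfand formula for TOTAL currents in the
`V → ∞` equilibrium ensemble; [corpus:editornd-thermal-transport-low-dimensions p.134 ref. 31] (Dhar's chapter citing KDN); galaxy:
`"Einstein-Helfand|open system Green-Kubo|Green-Kubo formula for open systems" --star all` → 9 rows, all MD transport-coefficient numerics
(e.g. [galaxy:pdf:-2592831018141780900] Bertossa–Grasselli–Ercole–Baroni 2018), none on a bath-heat Helfand moment of a finite chain;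
`"heat conduction in open systems|fluctuations of the heat exchanged|current fluctuations in open" --star pdf` → 3 rows (Stoltz HDR, Seifert 2012 review,
Zhu–Lei–Kim 2021), none with the split `W/2 = tγT²E + B`.  Delta in one sentence: the conductance deficit `E_N` of the finite open chain is identified
with the diffusivity of ONE reservoir's heat, with an exact finite-time remainder whose one-sided control by an `N`-uniform kernel floor closes the
blocker beneath (S).

## Barriers
technique_class: equilibrium fluctuation identities (Dynkin + detailed balance) + variance comparison; no spectral gap, no hypocoercivity, no decay
from `s = 0` is used or asked (`Literature.Barriers…SpectralGapClosingEquilibrium` not engaged: every statement is at fixed `N` or a one-sided floor).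
Phonon costume barrier (harmonic chain violates 11071): discharged piece by piece above — the phonon-false content sits in (BHᴾ_1) ⟸ (S), exactly
where NODE 105 put it; the new residual (BKᶠ_{0,3/2}) is phonon-TRUE and must be, since it is only sufficient jointly with (S).

Encoding: `N ≥ 2` for path statements (`Fin N` sites, bond `0`, site `1`), `N ≥ 1` for kernel statements; junk `else 0` branch of `bathKinCorr` at
`N = 0` never used (`∃ N₀` absorbs it); real exponents `(N:ℝ)^g`, `r^(−α)` evaluated at `r ≥ r₀ > 0` only.
Imports: tree only (NODE 106 `…ThoulessWindow`, the (S)-side kernel/Dynkin/covariance/bath-bond files, `BoundaryKernelBasics`).  0 sorry.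
-/

noncomputable section

open MeasureTheory ProbabilityTheory Filter Topology Set Function
open scoped NNReal ENNReal
open Literature.MathematicalPhysics.KineticTheory.HeatConduction
open Literature.MathematicalPhysics.KineticTheory OscillatorChain
open Literature.Probability.Process
open Summit.AtomisticToContinuum.FouriersLaw.Theorems.SubdiffusiveBondHeat
open Summit.AtomisticToContinuum.FouriersLaw.Theorems.SubdiffusiveBondHeat.EscapeGrading
open Summit.AtomisticToContinuum.FouriersLaw.Theorems.OddSectorIrreversibility

namespace Summit.AtomisticToContinuum.FouriersLaw.Theorems.BoundedResponse.HeatSpreading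

open Summit.AtomisticToContinuum.FouriersLaw.Theorems.BoundedResponse.TransientContact
open Summit.AtomisticToContinuum.FouriersLaw.Theorems.BoundedResponse.ParityFloor (extensiveBlockEnergyVariance_holds)
open Summit.AtomisticToContinuum.FouriersLaw.Theses.BondHeatUncertainty (BoundedResponse SubdiffusiveBondHeat)

/-! ## §0 Kernel pairings of the equal-temperature constructed kernels -/

/-- The KERNEL PAIRING `⟪f, P_u h⟫_T := ∫ f · (P_{u⁺} h) dμ_T` of the constructed transition kernels of the pinned chain at
equal bath temperatures `T`, against its Gibbs measure (`u⁺ = max(u,0)`). [formal bookkeeping] -/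
def kpair (ω₂ lam β γ T : ℝ) (N : ℕ) (f h : PhaseSpace N → ℝ) (u : ℝ) : ℝ :=
  ∫ z, f z * (∫ y, h y ∂((pinnedChain ω₂ lam β γ).transitionKernel N T T u.toNNReal z))
    ∂((pinnedChain ω₂ lam β γ).gibbsMeasure N T)

/-- The STATIC PAIRING `⟪f, h⟫_T := ∫ f h dμ_T`. [formal bookkeeping] -/
def spair (ω₂ lam β γ T : ℝ) (N : ℕ) (f h : PhaseSpace N → ℝ) : ℝ :=
  ∫ z, f z * h z ∂((pinnedChain ω₂ lam β γ).gibbsMeasure N T)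

section KernelTools

variable {ω₂ lam β γ : ℝ} (hω : 0 < ω₂) (hl : 0 < lam) (hβ : 0 < β) (hγ : 0 < γ) {N : ℕ} (hN : 1 < N)
  {T : ℝ} (hT : 0 < T)
include hω hl hβ hγ hN hT

/-- Gibbs invariance of the constructed kernels (tree: `pinnedChain_gibbsMeasure_bind_transitionKernel`). [folklore] -/
theorem pinnedChain_hinv_T :
    ∀ s : ℝ≥0, ((pinnedChain ω₂ lam β γ).gibbsMeasure N T).bind ((pinnedChain ω₂ lam β γ).transitionKernel N T T s) =
      (pinnedChain ω₂ lam β γ).gibbsMeasure N T :=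
  fun s => pinnedChain_gibbsMeasure_bind_transitionKernel hω hl.le hβ.le hγ.le (Nat.zero_lt_of_lt hN) hT s

/-- **Parity form of detailed balance**: if `f∘Θ = ε_f f` and `h∘Θ = ε_h h` (`Θ` = momentum reversal) then
`⟪f, P_u h⟫_T = ε_f ε_h ⟪h, P_u f⟫_T` (`f, h ∈ L²(μ_T)`).  From the tree's weak-`L²` detailed balance
`stub_kernelDetailedBalance`. [folklore] -/
theorem kpair_parity {f h : PhaseSpace N → ℝ} (hfm : Measurable f) (hhm : Measurable h)
    (hf2 : Integrable (fun y => f y ^ 2) ((pinnedChain ω₂ lam β γ).gibbsMeasure N T))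
    (hh2 : Integrable (fun y => h y ^ 2) ((pinnedChain ω₂ lam β γ).gibbsMeasure N T))
    {εf εh : ℝ} (hfp : ∀ y : PhaseSpace N, f (y.1, -y.2) = εf * f y) (hhp : ∀ y : PhaseSpace N, h (y.1, -y.2) = εh * h y)
    (u : ℝ) :
    kpair ω₂ lam β γ T N f h u = εf * εh * kpair ω₂ lam β γ T N h f u := by
  unfold kpair
  rw [stub_kernelDetailedBalance ω₂ lam β γ hω hl hβ hγ T hT N hN u.toNNReal f h hfm hhm hf2 hh2]
  simp only [hfp, hhp]
  have h : ∀ z : PhaseSpace N,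
      εh * h z * (∫ y, εf * f y ∂((pinnedChain ω₂ lam β γ).transitionKernel N T T u.toNNReal z)) =
        (εf * εh) * (h z * ∫ y, f y ∂((pinnedChain ω₂ lam β γ).transitionKernel N T T u.toNNReal z)) := by
    intro z
    rw [MeasureTheory.integral_const_mul]
    ring
  rw [integral_congr_ae (Eventually.of_forall h), MeasureTheory.integral_const_mul]

/-- For `g ∈ L²(μ_T)`: `g` is `P_u(z, ·)`-integrable for `μ_T`-a.e. `z` (invariance). [folklore] -/
theorem pinnedChain_ae_integrable_kernel {g : PhaseSpace N → ℝ} (hgm : Measurable g)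
    (hg2 : Integrable (fun y => g y ^ 2) ((pinnedChain ω₂ lam β γ).gibbsMeasure N T)) (u : ℝ≥0) :
    ∀ᵐ z ∂((pinnedChain ω₂ lam β γ).gibbsMeasure N T), Integrable g ((pinnedChain ω₂ lam β γ).transitionKernel N T T u z) := by
  haveI := pinnedChain_isProbabilityMeasure_gibbsMeasure hω hl.le hβ.le γ N hT
  haveI := pinnedChain_isMarkovKernel_transitionKernel hω hl.le hβ.le hγ.le N T T u
  have h1 : Integrable (fun _ : PhaseSpace N => (1 : ℝ) ^ 2) ((pinnedChain ω₂ lam β γ).gibbsMeasure N T) :=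
    integrable_const _
  have hce := pinnedChain_integrable_mul_compProd_of_invariant hω hl.le hβ.le hγ.le N T T
    ((pinnedChain ω₂ lam β γ).gibbsMeasure N T) u (pinnedChain_hinv_T hω hl hβ hγ hN hT u) measurable_const hgm h1 hg2
  have h2 := ((Measure.integrable_compProd_iff hce.aestronglyMeasurable).1 hce).1
  filter_upwards [h2] with z hz
  simpa only [one_mul] using hz

/-- **Linearity of the pairing in the evolved slot** (a.e. kernel integrability from invariance):
`⟪f, P_u (g − h)⟫ = ⟪f, P_u g⟫ − ⟪f, P_u h⟫`. [folklore] -/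
theorem kpair_sub_right {f g h : PhaseSpace N → ℝ} (hfm : Measurable f) (hgm : Measurable g) (hhm : Measurable h)
    (hf2 : Integrable (fun y => f y ^ 2) ((pinnedChain ω₂ lam β γ).gibbsMeasure N T))
    (hg2 : Integrable (fun y => g y ^ 2) ((pinnedChain ω₂ lam β γ).gibbsMeasure N T))
    (hh2 : Integrable (fun y => h y ^ 2) ((pinnedChain ω₂ lam β γ).gibbsMeasure N T)) (u : ℝ) :
    kpair ω₂ lam β γ T N f (fun y => g y - h y) u = kpair ω₂ lam β γ T N f g u - kpair ω₂ lam β γ T N f h u := by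
  haveI := pinnedChain_isProbabilityMeasure_gibbsMeasure hω hl.le hβ.le γ N hT
  unfold kpair
  beta_reduce
  have hinv := pinnedChain_hinv_T hω hl hβ hγ hN hT u.toNNReal
  have iG := (pinnedChain_integrable_mul_act_of_invariant hω hl.le hβ.le hγ.le N T T _ u.toNNReal hinv hfm hgm hf2 hg2).1
  have iH := (pinnedChain_integrable_mul_act_of_invariant hω hl.le hβ.le hγ.le N T T _ u.toNNReal hinv hfm hhm hf2 hh2).1
  rw [← integral_sub iG iH]
  refine integral_congr_ae ?_
  filter_upwards [pinnedChain_ae_integrable_kernel hω hl hβ hγ hN hT hgm hg2 u.toNNReal,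
    pinnedChain_ae_integrable_kernel hω hl hβ hγ hN hT hhm hh2 u.toNNReal] with z hzg hzh
  rw [integral_sub hzg hzh]
  ring

omit hω hl hβ hγ hN hT in
/-- `⟪f, P_u (c·h)⟫ = c ⟪f, P_u h⟫`. [formal bookkeeping] -/
theorem kpair_const_mul_right (f h : PhaseSpace N → ℝ) (c u : ℝ) :
    kpair ω₂ lam β γ T N f (fun y => c * h y) u = c * kpair ω₂ lam β γ T N f h u := by
  unfold kpair
  rw [← MeasureTheory.integral_const_mul]
  refine integral_congr_ae (Eventually.of_forall fun z => ?_)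
  beta_reduce
  rw [MeasureTheory.integral_const_mul]
  ring

omit hω hl hβ hγ hN hT in
/-- `⟪c·f, P_u h⟫ = c ⟪f, P_u h⟫`. [formal bookkeeping] -/
theorem kpair_const_mul_left (f h : PhaseSpace N → ℝ) (c u : ℝ) :
    kpair ω₂ lam β γ T N (fun y => c * f y) h u = c * kpair ω₂ lam β γ T N f h u := by
  unfold kpair
  rw [← MeasureTheory.integral_const_mul]
  refine integral_congr_ae (Eventually.of_forall fun z => ?_)
  beta_reduce
  ring

/-- **Integrated Dynkin identity in pairing form** (tree `pinnedChain_integral_mul_act_sub_of_dynkin`): if `e` satisfies Dynkin's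
identity for the constructed kernels with drift `ℓ`, then `⟪f, P_r e⟫ − ⟪f, e⟫ = ∫₀ʳ ⟪f, P_s ℓ⟫ ds` (`r ≥ 0`). [folklore] -/
theorem kpair_dynkin {f e ℓ : PhaseSpace N → ℝ} (hfm : Measurable f) (hem : Measurable e) (hℓm : Measurable ℓ)
    (hf2 : Integrable (fun y => f y ^ 2) ((pinnedChain ω₂ lam β γ).gibbsMeasure N T))
    (he2 : Integrable (fun y => e y ^ 2) ((pinnedChain ω₂ lam β γ).gibbsMeasure N T))
    (hℓ2 : Integrable (fun y => ℓ y ^ 2) ((pinnedChain ω₂ lam β γ).gibbsMeasure N T))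
    (hdyn : ∀ (r : ℝ≥0) (z : PhaseSpace N),
      ∫ y, e y ∂((pinnedChain ω₂ lam β γ).transitionKernel N T T r z) - e z =
        ∫ s in (0 : ℝ)..(r : ℝ), ∫ y, ℓ y ∂((pinnedChain ω₂ lam β γ).transitionKernel N T T s.toNNReal z))
    {r : ℝ} (hr : 0 ≤ r) :
    kpair ω₂ lam β γ T N f e r - spair ω₂ lam β γ T N f e = ∫ s in (0 : ℝ)..r, kpair ω₂ lam β γ T N f ℓ s := by
  haveI := pinnedChain_isProbabilityMeasure_gibbsMeasure hω hl.le hβ.le γ N hT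
  exact pinnedChain_integral_mul_act_sub_of_dynkin hω hl.le hβ.le hγ.le N T T _ (pinnedChain_hinv_T hω hl hβ hγ hN hT)
    hfm hem hℓm hf2 he2 hℓ2 hdyn hr

/-- Interval integrability of `u ↦ ⟪f, P_u h⟫` (tree). [folklore] -/
theorem intervalIntegrable_kpair {f h : PhaseSpace N → ℝ} (hfm : Measurable f) (hhm : Measurable h)
    (hf2 : Integrable (fun y => f y ^ 2) ((pinnedChain ω₂ lam β γ).gibbsMeasure N T))
    (hh2 : Integrable (fun y => h y ^ 2) ((pinnedChain ω₂ lam β γ).gibbsMeasure N T)) (a b : ℝ) :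
    IntervalIntegrable (kpair ω₂ lam β γ T N f h) volume a b := by
  haveI := pinnedChain_isProbabilityMeasure_gibbsMeasure hω hl.le hβ.le γ N hT
  exact pinnedChain_intervalIntegrable_kernelPairing hω hl.le hβ.le hγ.le N T T _ (pinnedChain_hinv_T hω hl hβ hγ hN hT)
    hfm hhm hf2 hh2 a b

/-- The triangle identity `∫₀ᵗ ∫₀ˢ ⟪f, P_u h⟫ du ds = ∫₀ᵗ (t − r) ⟪f, P_r h⟫ dr` (tree). [folklore] -/
theorem kpair_triangle {f h : PhaseSpace N → ℝ} (hfm : Measurable f) (hhm : Measurable h)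
    (hf2 : Integrable (fun y => f y ^ 2) ((pinnedChain ω₂ lam β γ).gibbsMeasure N T))
    (hh2 : Integrable (fun y => h y ^ 2) ((pinnedChain ω₂ lam β γ).gibbsMeasure N T)) {t : ℝ} (ht : 0 ≤ t) :
    ∫ s in (0 : ℝ)..t, (∫ u in (0 : ℝ)..s, kpair ω₂ lam β γ T N f h u) =
      ∫ r in (0 : ℝ)..t, (t - r) * kpair ω₂ lam β γ T N f h r := by
  haveI := pinnedChain_isProbabilityMeasure_gibbsMeasure hω hl.le hβ.le γ N hT
  exact pinnedChain_integral_integral_kernelPairing_triangle hω hl.le hβ.le hγ.le N T T _ (pinnedChain_hinv_T hω hl hβ hγ hN hT)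
    hfm hhm hf2 hh2 ht

/-- **Doubly integrated Dynkin identity**: `∫₀ᵗ ⟪f, P_u e⟫ du = t ⟪f, e⟫ + ∫₀ᵗ (t − r) ⟪f, P_r ℓ⟫ dr` (`t ≥ 0`). [folklore] -/
theorem integral_kpair_eq_of_dynkin {f e ℓ : PhaseSpace N → ℝ} (hfm : Measurable f) (hem : Measurable e) (hℓm : Measurable ℓ)
    (hf2 : Integrable (fun y => f y ^ 2) ((pinnedChain ω₂ lam β γ).gibbsMeasure N T))
    (he2 : Integrable (fun y => e y ^ 2) ((pinnedChain ω₂ lam β γ).gibbsMeasure N T))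
    (hℓ2 : Integrable (fun y => ℓ y ^ 2) ((pinnedChain ω₂ lam β γ).gibbsMeasure N T))
    (hdyn : ∀ (r : ℝ≥0) (z : PhaseSpace N),
      ∫ y, e y ∂((pinnedChain ω₂ lam β γ).transitionKernel N T T r z) - e z =
        ∫ s in (0 : ℝ)..(r : ℝ), ∫ y, ℓ y ∂((pinnedChain ω₂ lam β γ).transitionKernel N T T s.toNNReal z))
    {t : ℝ} (ht : 0 ≤ t) :
    ∫ u in (0 : ℝ)..t, kpair ω₂ lam β γ T N f e u =
      t * spair ω₂ lam β γ T N f e + ∫ r in (0 : ℝ)..t, (t - r) * kpair ω₂ lam β γ T N f ℓ r := by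
  have hpt : ∀ u ∈ uIcc (0 : ℝ) t, kpair ω₂ lam β γ T N f e u =
      spair ω₂ lam β γ T N f e + ∫ s in (0 : ℝ)..u, kpair ω₂ lam β γ T N f ℓ s := by
    intro u hu
    rw [uIcc_of_le ht] at hu
    have h := kpair_dynkin hω hl hβ hγ hN hT hfm hem hℓm hf2 he2 hℓ2 hdyn hu.1
    linarith
  have hprim : IntervalIntegrable (fun u => ∫ s in (0 : ℝ)..u, kpair ω₂ lam β γ T N f ℓ s) volume 0 t :=
    (intervalIntegral.continuous_primitive (fun a b => intervalIntegrable_kpair hω hl hβ hγ hN hT hfm hℓm hf2 hℓ2 a b)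
      0).intervalIntegrable _ _
  rw [intervalIntegral.integral_congr hpt, intervalIntegral.integral_add intervalIntegrable_const hprim,
    intervalIntegral.integral_const, kpair_triangle hω hl hβ hγ hN hT hfm hℓm hf2 hℓ2 ht]
  simp only [sub_zero, smul_eq_mul]

end KernelTools

end Summit.AtomisticToContinuum.FouriersLaw.Theorems.BoundedResponse.HeatSpreading

end
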